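import Literature.Probability.RandomPlanarGeometry.LSW2004LoewnerExpansion
import HarnessLib

/-!
# [LSW04] eq. (4.11), derivative half: `g_t′(z) = 1 − 2t/z² + O(δ³)` for `t ≤ 2δ²`, `sup |W| ≤ 2δ`

G. F. Lawler, O. Schramm, W. Werner, *Conformal invariance of planar loop-erased random walks and
uniform spanning trees*, Ann. Probab. **32** (2004) 939–995 (**[LSW04]**), proof of Prop. 4.3 (the
key estimate), eq. (4.11). This is the derivative companion of `LSW2004LoewnerExpansion.lean`
(`Loewner.norm_map_sub_sub_le_of_small`: `g_t(z) = z + 2t/z + O(δ³)`): in the same small-time,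
small-driver regime — `0 < δ ≤ δ₀`, a continuous driving function `W` with `|W_s| ≤ 2δ` on
`[0, t]`, `t ≤ 2δ²`, and a point with `1/2 ≤ |z| ≤ 3` — the chordal Loewner map `g_t = map W t`
satisfies `|g_t′(z) − (1 − 2t/z²)| ≤ C δ³`. The derivative expansion is what the one-step value
of a boundary-touching martingale observable needs (its functional involves `g_t′(x)` through
`x² g_t′(x)² / (g_t(x) − W_t)²` at far real points `x`), alongside the expansion of `g_t(x)`.

Proof-only file: exactly as `norm_map_sub_sub_le_of_small` specialises the tree's far-field
expansion `Loewner.FarRegime.norm_g_sub_expansion_le`, the statement here is the specialisation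
of the tree's far-field derivative estimate `Loewner.FarRegime.norm_deriv_map_sub_le`
(`LoewnerFarField.lean`: `‖g_t′(z) − (1 − 2t/z²)‖ ≤ 11 α³`, `α = (K + √t)/|z|`) to driver bound
`K = 2δ`, times `t ≤ 2δ²` (so `√t ≤ 2δ`) and points `|z| ≥ 1/2`: then `64 (K + √t) ≤ 256 δ ≤ 1/2`
puts `z` in the far regime and `α ≤ 4δ/|z| ≤ 8δ`, whence `11 α³ ≤ 11 · 512 δ³ ≤ 6000 δ³`.

* `Loewner.norm_deriv_map_sub_le_of_small` — the estimate with the absolute constants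
  `δ₀ = 1/600`, `C = 6000`.
* `Loewner.exists_norm_deriv_map_sub_le` — the same in `∃ δ₀ C` form.
* `Loewner.exists_norm_map_and_deriv_sub_le` — both halves of (4.11) with one pair `(δ₀, C)`:
  `|g_t(z) − z − 2t/z| ≤ C δ³` and `|g_t′(z) − (1 − 2t/z²)| ≤ C δ³`.

## References

* [LSW04] Prop. 4.3, proof, eq. (4.11) [LawlerSchrammWerner2004].
* G. F. Lawler, *Conformally Invariant Processes in the Plane* (2005), §4.1, Lemma 4.13
  [Lawler2005].
-/

noncomputable section

open Set Filter Topology Metric MeasureTheory Complex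
open scoped NNReal

namespace Literature.Probability.RandomPlanarGeometry

namespace Loewner

/-- **[LSW04] eq. (4.11), derivative: `g_t′(z) = 1 − 2t/z² + O(δ³)`.** With the absolute
constants `δ₀ = 1/600` and `C = 6000`: for `0 < δ ≤ δ₀`, a continuous driving function with
`|W_s| ≤ 2δ` for `s ∈ [0, t]`, `t ≤ 2δ²`, and `1/2 ≤ |z| ≤ 3`, the chordal Loewner map satisfies
`|g_t′(z) − (1 − 2t/z²)| ≤ C δ³`. Proof: `z` is in the far-field regime with `K = 2δ`
(`64 (2δ + √t) ≤ 64 · 4δ ≤ 1/2 ≤ |z|`), so by `FarRegime.norm_deriv_map_sub_le`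
`|g_t′(z) − (1 − 2t/z²)| ≤ 11 α³` with `α = (2δ + √t)/|z| ≤ 8δ`, and `11 (8δ)³ = 5632 δ³`. The
upper bound `|z| ≤ 3` is not used by this half of (4.11) (the remainder `11 α³` carries no factor
`|z|`, unlike the `32 α⁴ |z|` of the expansion of `g_t(z)`); it is kept so that the two halves
have the same hypotheses (`exists_norm_map_and_deriv_sub_le`).
[cite: LawlerSchrammWerner2004, Prop. 4.3 (proof, eq. (4.11))] -/
theorem norm_deriv_map_sub_le_of_small {δ : ℝ} (hδ : 0 < δ) (hδ₀ : δ ≤ 1 / 600) {W : ℝ≥0 → ℝ}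
    (hW : Continuous W) {t : ℝ≥0} (ht : (t : ℝ) ≤ 2 * δ ^ 2)
    (hWb : ∀ u ∈ Icc (0 : ℝ) t, |W u.toNNReal| ≤ 2 * δ) {z : ℂ} (hz1 : 1 / 2 ≤ ‖z‖)
    (_hz2 : ‖z‖ ≤ 3) : ‖deriv (map W t) z - (1 - 2 * t / z ^ 2)‖ ≤ 6000 * δ ^ 3 := by
  -- the far-field regime with `K = 2δ`
  have hsqrt : Real.sqrt t ≤ 2 * δ := by
    rw [Real.sqrt_le_left (by linarith)]
    nlinarith
  have hfar : FarRegime W z t (2 * δ) :=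
    { cont := hW
      bound := hWb
      far := by
        have : 64 * (2 * δ + Real.sqrt t) ≤ 64 * (4 * δ) := by gcongr; linarith
        linarith
      pos := by linarith }
  obtain ⟨g, hg⟩ := hfar.exists_sol
  have hd := hfar.norm_deriv_map_sub_le hg
  -- the expansion parameter `α ≤ 8δ`
  set α : ℝ := (2 * δ + Real.sqrt t) / ‖z‖ with hα
  have hα0 : 0 ≤ α := by positivity
  have hαle : α ≤ 8 * δ := by
    rw [hα, div_le_iff₀ (by linarith)]
    nlinarith [Real.sqrt_nonneg (t : ℝ)]
  calc ‖deriv (map W t) z - (1 - 2 * t / z ^ 2)‖ ≤ 11 * α ^ 3 := hd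
    _ ≤ 11 * (8 * δ) ^ 3 := by gcongr
    _ ≤ 6000 * δ ^ 3 := by nlinarith [pow_nonneg hδ.le 3]

/-- **(4.11), derivative, in `∃ δ₀ C` form**, for consumers quantifying over the smallness
parameter: there are `δ₀ > 0` and `C` with `|g_t′(z) − (1 − 2t/z²)| ≤ C δ³` whenever
`0 < δ ≤ δ₀`, `|W| ≤ 2δ` on `[0, t]`, `t ≤ 2δ²`, `1/2 ≤ |z| ≤ 3`.
[cite: LawlerSchrammWerner2004, Prop. 4.3 (proof, eq. (4.11))] -/
theorem exists_norm_deriv_map_sub_le :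
    ∃ δ₀ : ℝ, 0 < δ₀ ∧ ∃ C : ℝ, ∀ δ : ℝ, 0 < δ → δ ≤ δ₀ → ∀ (W : ℝ≥0 → ℝ), Continuous W →
      ∀ t : ℝ≥0, (t : ℝ) ≤ 2 * δ ^ 2 → (∀ u ∈ Icc (0 : ℝ) t, |W u.toNNReal| ≤ 2 * δ) →
        ∀ z : ℂ, 1 / 2 ≤ ‖z‖ → ‖z‖ ≤ 3 →
          ‖deriv (map W t) z - (1 - 2 * t / z ^ 2)‖ ≤ C * δ ^ 3 :=
  ⟨1 / 600, by norm_num, 6000, fun _ hδ hδ₀ _ hW _ ht hWb _ hz1 hz2 ↦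
    norm_deriv_map_sub_le_of_small hδ hδ₀ hW ht hWb hz1 hz2⟩

/-- Both expansions at once, for consumers: `g_t(z) = z + 2t/z + O(δ³)` and
`g_t′(z) = 1 − 2t/z² + O(δ³)` with one pair `(δ₀, C)`. There are `δ₀ > 0` and `C` such that for
`0 < δ ≤ δ₀`, continuous `W` with `|W| ≤ 2δ` on `[0, t]`, `t ≤ 2δ²`, and `1/2 ≤ |z| ≤ 3`:
`|g_t(z) − z − 2t/z| ≤ C δ³` and `|g_t′(z) − (1 − 2t/z²)| ≤ C δ³` (here `δ₀ = 1/600`,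
`C = 6000 = max(700, 6000)`, from `norm_map_sub_sub_le_of_small` and
`norm_deriv_map_sub_le_of_small`). [cite: LawlerSchrammWerner2004, Prop. 4.3 (proof, eq. (4.11))] -/
theorem exists_norm_map_and_deriv_sub_le :
    ∃ δ₀ : ℝ, 0 < δ₀ ∧ ∃ C : ℝ, ∀ δ : ℝ, 0 < δ → δ ≤ δ₀ → ∀ (W : ℝ≥0 → ℝ), Continuous W →
      ∀ t : ℝ≥0, (t : ℝ) ≤ 2 * δ ^ 2 → (∀ u ∈ Icc (0 : ℝ) t, |W u.toNNReal| ≤ 2 * δ) →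
        ∀ z : ℂ, 1 / 2 ≤ ‖z‖ → ‖z‖ ≤ 3 →
          ‖map W t z - z - 2 * t / z‖ ≤ C * δ ^ 3 ∧
            ‖deriv (map W t) z - (1 - 2 * t / z ^ 2)‖ ≤ C * δ ^ 3 :=
  ⟨1 / 600, by norm_num, 6000, fun _ hδ hδ₀ _ hW _ ht hWb _ hz1 hz2 ↦
    ⟨(norm_map_sub_sub_le_of_small hδ hδ₀ hW ht hWb hz1 hz2).trans
        (mul_le_mul_of_nonneg_right (by norm_num) (pow_nonneg hδ.le 3)),
      norm_deriv_map_sub_le_of_small hδ hδ₀ hW ht hWb hz1 hz2⟩⟩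

end Loewner

end Literature.Probability.RandomPlanarGeometry

end
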